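import Literature.Analysis.FluidPDE.PressureFreeEpsilonRegularityAssembly
import Literature.Analysis.FluidPDE.KwonDecompositionClasses
import Literature.Analysis.FluidPDE.KwonForceDivFree
import Literature.Analysis.FluidPDE.KwonForceBounds
import Literature.Analysis.FluidPDE.KwonVelocityGradient
import HarnessLib

/-!
# Kwon's Lemma 2.5 at `r = m = 3`: the assembly, modulo the local energy inequality

Analysis/FluidPDE proof file (theorems only; no definitions, no named facts) on the discharge
path of the named fact `Literature.Analysis.FluidPDE.kwon2023_velocity_epsilon_regularity`
(`PressureFreeEpsilonRegularity.lean`; H. Kwon, J. Differential Equations 357 (2023) =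
arXiv:2104.03160, Thm. 1.4). The §4 assembly `kwon2023_velocity_epsilon_regularity_of_lemma25_of_thm31`
(`PressureFreeEpsilonRegularityAssembly.lean`) reduces Thm. 1.4 (case `r = m = 3`, CKN class)
to Lemma 2.5 (binder `h25`) and Thm. 3.1 (binder `h31`). This file ASSEMBLES the binder `h25` —
Lemma 2.5 at `r = m = 3` on `Q₂(0) → Q₁(0)` for the CKN-suitable class — from the tree's bricks
(2026-08-17 … 2026-08-28: `KwonSpaceTimeFields`, `KwonDecompositionMomentum`,
`KwonDecompositionClasses`, `KwonForceDivFree`, `KwonDriftBounds`, `KwonPressureBounds`,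
`KwonForceBounds`), modulo the ONE remaining clause of Def. 2.4 not yet in the tree, the local
energy inequality of the perturbed system (Kwon p. 9: the mollification / Duchon–Robert-type
commutator argument, "the key lemma in [CLRM18]"), which enters as the hypothesis `hLE`, stated
for Kwon's explicit fields:

* `exists_isGoodVelocity_of_suitable` — the CKN data on `Q₂(0)` (`u ∈ L³(Q₂)`: `C(2) < ∞`;
  `u ∈ L^∞_tL²_x`: `A_ess(2) < ∞`) give a good representative `W` (`exists_isGoodVelocity`);
* `kwon2023_lemma25_cubic_of_localEnergy hLE : «h25»` — with `v = W − h`, `h = H(W(t))`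
  (`driftField`), `∇h = driftGrad W`, `f = forceField W`, `q = pressureField W P` (`P` from
  `exists_pressureField_representative`): the decomposition `u = v + h` a.e. on `Q₁(0)`
  (`ae_eq_add_driftField`), the fifteen clauses of `Kwon2023.IsPerturbedSuitableOn (Q₁(0)) 1 h Dh f v q`
  (fourteen by name from the tree, `localEnergy` from `hLE`), `h ∈ L^∞(Q_{1/2}(0))`
  (`eLpNorm_driftField_top_lt_top`), and the four estimates (est.v), (est.q), (est.h), (est.f)
  (`exists_eLpNorm_sub_driftField_le`, `exists_pressureField_representative`,
  `exists_driftNorm_le`, `exists_forceNorm_le`) with `C₁` the maximum of the four constants and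
  `‖W‖_{L³(Q₂(0))} = ‖u‖_{L³(Q₂(0))}`;
* `kwon2023_lemma25_cubic_of_localEnergyIneq` / `kwon2023_velocity_epsilon_regularity_of_localEnergyIneq_of_thm31`
  — the same with the hypothesis narrowed to the bare INEQUALITY for the explicit gradient
  `G − driftGrad W` (`KwonVelocityGradient.lean`: `hasWeakSpatialGradientOn_sub_driftField`,
  `lintegral_frobeniusNormSq_sub_driftGrad_lt_top`);
* `kwon2023_velocity_epsilon_regularity_of_localEnergy_of_thm31 hLE h31 :
  kwon2023_velocity_epsilon_regularity` — HENCE the discharge debt of the INPUT Thm. 1.4 is now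
  exactly `hLE` (the `localEnergy` clause of Lemma 2.5 for Kwon's fields) and `h31` (Thm. 3.1).

No NS-regularity statement is touched (Thm. 1.4 is an INPUT; this re-proves part of it).

## Mathlib / tree search

Tree (reused, all by name): `kwon2023_velocity_epsilon_regularity_of_lemma25_of_thm31`
(`PressureFreeEpsilonRegularityAssembly`); `exists_isGoodVelocity`, `IsGoodVelocity`,
`driftField`, `driftGrad`, `forceField`, `pressureField`, `stronglyMeasurable_uncurry_forceField`
(`KwonSpaceTimeFields`); `momentum_perturbed_pressureField`, `divFree_sub_driftField`,
`divFree_driftField`, `parabolicCylinderOpens_one_le_kwonCyl` (`KwonDecompositionMomentum`);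
`hasWeakSpatialGradientOn_driftField`, `driftClass_driftField`, `energyClass_sub_driftField`,
`ae_eq_add_driftField`, `locallyIntegrableOn(_sq)_of_eq_sub_driftField`,
`aestronglyMeasurable_of_eq_pressureField/forceField` (`KwonDecompositionClasses`);
`divFree_forceField` (`KwonForceDivFree`); `exists_eLpNorm_sub_driftField_le`,
`exists_driftNorm_le`, `eLpNorm_driftField_top_lt_top` (`KwonDriftBounds`);
`exists_pressureField_representative` (`KwonPressureBounds`); `exists_forceNorm_le`,
`exists_forall_norm_forceField_le`, `lintegral_sqrt_lintegral_indicator_forceField_sq_lt_top`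
(`KwonForceBounds`); `hasWeakSpatialGradientOn_sub_driftField`,
`lintegral_frobeniusNormSq_sub_driftGrad_lt_top` (`KwonVelocityGradient`); `cknAEss` (`LocalTypeI`), `cknC` (`SuitableWeak`),
`IsSuitableWeakSolutionOn.distributional`. Mathlib: `ENNReal.ae_le_essSup`,
`ENNReal.mul_lt_top_iff`, `eLpNorm_congr_ae`, `memLp_top_of_bound`.

## References

* H. Kwon, *The role of the pressure in the regularity theory for the Navier–Stokes equations*,
  J. Differential Equations 357 (2023) = arXiv:2104.03160: Lemma 2.5 (arXiv p. 7), its proof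
  (pp. 8–9), Def. 2.4, §4 (p. 15). [Kwon2023RolePressure]
-/

noncomputable section

open MeasureTheory Set Function Filter Topology TopologicalSpace Metric InnerProductSpace
open scoped NNReal ENNReal RealInnerProductSpace Laplacian

namespace Literature.Analysis.FluidPDE

open Kwon2023

/-! ### From the CKN data on `Q₂(0)` to a good representative -/

/-- `Q₂(0) = (−4, 0) × B₂`. [folklore] -/
private theorem parabolicCylinder_two_zero' :
    parabolicCylinder 2 (0 : ℝ × EuclideanSpace ℝ (Fin 3)) =
      Ioo (-4 : ℝ) 0 ×ˢ ball (0 : EuclideanSpace ℝ (Fin 3)) 2 := by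
  rw [parabolicCylinder]
  norm_num

/-- `Q₁(0) = (−1, 0) × B₁`. [folklore] -/
private theorem parabolicCylinder_one_zero' :
    parabolicCylinder 1 (0 : ℝ × EuclideanSpace ℝ (Fin 3)) =
      Ioo (-1 : ℝ) 0 ×ˢ ball (0 : EuclideanSpace ℝ (Fin 3)) 1 := by
  rw [parabolicCylinder]
  norm_num

/-- From `A_ess(2) < ∞`: the slices of `u` have bounded `L²(B₂)` norms for a.e. `t ∈ (−4,0)`. [folklore] -/
private theorem ae_lintegral_ball_sq_le_of_cknAEss_lt_top
    {u : ℝ → EuclideanSpace ℝ (Fin 3) → EuclideanSpace ℝ (Fin 3)}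
    (hA : cknAEss 2 (0 : ℝ × EuclideanSpace ℝ (Fin 3)) u < ⊤) :
    ∀ᵐ t : ℝ, t ∈ Ioo (-4 : ℝ) 0 →
      ∫⁻ x in ball (0 : EuclideanSpace ℝ (Fin 3)) 2, ‖u t x‖ₑ ^ (2 : ℕ) ≤
        ENNReal.ofReal 2 * cknAEss 2 (0 : ℝ × EuclideanSpace ℝ (Fin 3)) u := by
  have hr0 : ENNReal.ofReal (2 : ℝ) ≠ 0 := (ENNReal.ofReal_pos.2 two_pos).ne'
  have h1 := ENNReal.ae_le_essSup
    (fun t : ℝ => (ENNReal.ofReal (2 : ℝ))⁻¹ * ∫⁻ x in ball (0 : EuclideanSpace ℝ (Fin 3)) 2, ‖u t x‖ₑ ^ 2)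
    (μ := volume.restrict (Ioo ((0 : ℝ × EuclideanSpace ℝ (Fin 3)).1 - 2 ^ 2) (0 : ℝ × EuclideanSpace ℝ (Fin 3)).1))
  have hI : Ioo ((0 : ℝ × EuclideanSpace ℝ (Fin 3)).1 - 2 ^ 2) (0 : ℝ × EuclideanSpace ℝ (Fin 3)).1 = Ioo (-4 : ℝ) 0 := by
    norm_num
  rw [hI, ae_restrict_iff' measurableSet_Ioo] at h1
  filter_upwards [h1] with t ht htI
  have h2 : (ENNReal.ofReal (2 : ℝ))⁻¹ * ∫⁻ x in ball (0 : EuclideanSpace ℝ (Fin 3)) 2, ‖u t x‖ₑ ^ 2 ≤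
      cknAEss 2 (0 : ℝ × EuclideanSpace ℝ (Fin 3)) u := by
    have h := ht htI
    rw [cknAEss, hI]
    exact h
  have hA' := hA
  calc ∫⁻ x in ball (0 : EuclideanSpace ℝ (Fin 3)) 2, ‖u t x‖ₑ ^ 2
      = ENNReal.ofReal 2 * ((ENNReal.ofReal (2 : ℝ))⁻¹ *
          ∫⁻ x in ball (0 : EuclideanSpace ℝ (Fin 3)) 2, ‖u t x‖ₑ ^ 2) := by
        rw [← mul_assoc, ENNReal.mul_inv_cancel hr0 ENNReal.ofReal_ne_top, one_mul]
    _ ≤ ENNReal.ofReal 2 * cknAEss 2 (0 : ℝ × EuclideanSpace ℝ (Fin 3)) u := by gcongr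

/-- **A good representative of the velocity.** Under the CKN classes on `Q₂(0)` (`u ∈ L³(Q₂)`,
`A_ess(2) < ∞`), the zero extension of `u` agrees a.e. with a good velocity field `W`
(`Kwon2023.exists_isGoodVelocity`). [cite: Kwon2023RolePressure, Lemma 2.5 (proof, p. 8) with Def. 1.1] -/
theorem exists_isGoodVelocity_of_suitable
    {u : ℝ → EuclideanSpace ℝ (Fin 3) → EuclideanSpace ℝ (Fin 3)} {p : ℝ → EuclideanSpace ℝ (Fin 3) → ℝ}
    (hs : IsSuitableWeakSolutionOn (parabolicCylinderOpens 2 (0 : ℝ × EuclideanSpace ℝ (Fin 3))) 1 0 u p)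
    (hA : cknAEss 2 (0 : ℝ × EuclideanSpace ℝ (Fin 3)) u < ⊤)
    (hC : cknC 2 (0 : ℝ × EuclideanSpace ℝ (Fin 3)) u < ⊤) :
    ∃ W, IsGoodVelocity W ∧
      uncurry W =ᵐ[volume] (parabolicCylinder 2 (0 : ℝ × EuclideanSpace ℝ (Fin 3))).indicator (uncurry u) := by
  have hum : AEStronglyMeasurable (uncurry u)
      (volume.restrict (parabolicCylinder 2 (0 : ℝ × EuclideanSpace ℝ (Fin 3)))) :=
    hs.distributional.1.aestronglyMeasurable
  have hu3 : ∫⁻ z in parabolicCylinder 2 (0 : ℝ × EuclideanSpace ℝ (Fin 3)), ‖uncurry u z‖ₑ ^ (3 : ℕ) < ⊤ := by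
    have hne : (ENNReal.ofReal (2 : ℝ) ^ 2)⁻¹ ≠ 0 :=
      ENNReal.inv_ne_zero.2 (ENNReal.pow_ne_top ENNReal.ofReal_ne_top)
    have h := hC
    rw [cknC] at h
    rcases ENNReal.mul_lt_top_iff.1 h with h' | h' | h'
    · exact h'.2
    · exact absurd h' hne
    · rw [show (∫⁻ z in parabolicCylinder 2 (0 : ℝ × EuclideanSpace ℝ (Fin 3)), ‖uncurry u z‖ₑ ^ (3 : ℕ)) = 0 from h']
      exact ENNReal.zero_lt_top
  exact exists_isGoodVelocity hum hu3 (A := ENNReal.ofReal 2 * cknAEss 2 (0 : ℝ × EuclideanSpace ℝ (Fin 3)) u)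
    (ENNReal.mul_lt_top ENNReal.ofReal_lt_top hA) (ae_lintegral_ball_sq_le_of_cknAEss_lt_top hA)

/-- `‖W‖_{L³(Q₂(0))} = ‖u‖_{L³(Q₂(0))}` for a representative. [folklore] -/
private theorem eLpNorm_repr_eq {u W : ℝ → EuclideanSpace ℝ (Fin 3) → EuclideanSpace ℝ (Fin 3)}
    (hWu : uncurry W =ᵐ[volume] (parabolicCylinder 2 (0 : ℝ × EuclideanSpace ℝ (Fin 3))).indicator (uncurry u))
    (p : ℝ≥0∞) :
    eLpNorm (uncurry W) p (volume.restrict (parabolicCylinder 2 (0 : ℝ × EuclideanSpace ℝ (Fin 3)))) =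
      eLpNorm (uncurry u) p (volume.restrict (parabolicCylinder 2 (0 : ℝ × EuclideanSpace ℝ (Fin 3)))) := by
  refine eLpNorm_congr_ae ?_
  filter_upwards [ae_restrict_mem (isOpen_parabolicCylinder 2 _).measurableSet, ae_restrict_of_ae hWu]
    with z hz hWz
  rw [hWz, indicator_of_mem hz]

/-- Kwon's force is locally integrable on space–time (it is bounded). [cite: Kwon2023RolePressure, Lemma 2.5 (est.f)] -/
theorem locallyIntegrableOn_forceField {W : ℝ → EuclideanSpace ℝ (Fin 3) → EuclideanSpace ℝ (Fin 3)}
    (hW : IsGoodVelocity W) (S : Set (ℝ × EuclideanSpace ℝ (Fin 3))) :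
    LocallyIntegrableOn (uncurry (forceField W)) S volume := by
  obtain ⟨M, hM⟩ := exists_forall_norm_forceField_le hW
  exact ((memLp_top_of_bound (stronglyMeasurable_uncurry_forceField hW).aestronglyMeasurable M
    (Eventually.of_forall fun z => hM z.1 z.2)).locallyIntegrable le_top).locallyIntegrableOn _

/-! ### The assembly -/

/-- **Kwon 2023, Lemma 2.5 at `r = m = 3` for the CKN-suitable class, assembled from the tree's
bricks modulo the local energy inequality of the perturbed system.** Given, as the hypothesis
`hLE`, the `localEnergy` clause of Def. 2.4 (Kwon p. 9: the mollification / commutator argument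
"`2∫|∇v|²ξ ≤ lim inf (μ_ε − η_ε)(ξ) + …`") for Kwon's explicit fields
`v = W − h`, `h = H(W(t))` (`driftField`), `∇h` (`driftGrad`), `f` (`forceField`),
`q` (`pressureField W P`) on `Q₁(0)`, for every suitable `(u, p)` on `Q₂(0)` in the CKN class of
Thm. 1.4, every good representative `W` of `u` and every jointly measurable Riesz representative
`P`, the conclusion of Lemma 2.5 holds in the form consumed by the §4 assembly
(`kwon2023_unitScale_of_lemma25_of_thm31`, binder `h25`): decomposition `u = v + h` a.e. on
`Q₁(0)`, `(v, q)` perturbed-suitable on `Q₁(0)` with drift `h` and force `f` (Def. 2.4, `λ = 1`: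
the fourteen other clauses are the tree's `momentum_perturbed_pressureField`,
`divFree_sub_driftField`, `divFree_driftField`, `divFree_forceField`,
`hasWeakSpatialGradientOn_driftField`, `driftClass_driftField`, `energyClass_sub_driftField`,
the measurability / local integrability lemmas, `setLIntegral_pressureField_rpow_lt_top`,
`lintegral_sqrt_lintegral_indicator_forceField_sq_lt_top`), `h ∈ L^∞(Q_{1/2}(0))`, and the four
estimates (est.v), (est.q), (est.h), (est.f) (`exists_eLpNorm_sub_driftField_le`,
`exists_pressureField_representative`, `exists_driftNorm_le`, `exists_forceNorm_le`).
[cite: Kwon2023RolePressure, Lemma 2.5 (arXiv p. 7) with its proof pp. 8–9, case r = m = 3] -/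
theorem kwon2023_lemma25_cubic_of_localEnergy
    (hLE : ∀ (u : ℝ → EuclideanSpace ℝ (Fin 3) → EuclideanSpace ℝ (Fin 3))
      (p : ℝ → EuclideanSpace ℝ (Fin 3) → ℝ)
      (W : ℝ → EuclideanSpace ℝ (Fin 3) → EuclideanSpace ℝ (Fin 3))
      (P : ℝ → EuclideanSpace ℝ (Fin 3) → ℝ),
      IsSuitableWeakSolutionOn (parabolicCylinderOpens 2 0) 1 0 u p →
      cknAEss 2 0 u < ⊤ →
      (∃ G : ℝ → EuclideanSpace ℝ (Fin 3) →
          EuclideanSpace ℝ (Fin 3) →L[ℝ] EuclideanSpace ℝ (Fin 3),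
        HasWeakSpatialGradientOn (parabolicCylinderOpens 2 0) u G ∧ cknE 2 0 G < ⊤) →
      cknD 2 (0 : ℝ × EuclideanSpace ℝ (Fin 3)) p < ⊤ →
      cknC 2 0 u < ⊤ →
      IsGoodVelocity W →
      uncurry W =ᵐ[volume] (parabolicCylinder 2 (0 : ℝ × EuclideanSpace ℝ (Fin 3))).indicator (uncurry u) →
      StronglyMeasurable (uncurry P) →
      (∀ᵐ t ∂(volume.restrict (Ioo (-4 : ℝ) 0)), P t =ᵐ[volume] rieszPressure (sqrtCutoffSMul (W t))) →
      ∃ G : ℝ → EuclideanSpace ℝ (Fin 3) → EuclideanSpace ℝ (Fin 3) →L[ℝ] EuclideanSpace ℝ (Fin 3),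
        HasWeakSpatialGradientOn (parabolicCylinderOpens 1 (0 : ℝ × EuclideanSpace ℝ (Fin 3)))
          (fun t x => W t x - driftField W t x) G ∧
        (∫⁻ z in (parabolicCylinderOpens 1 (0 : ℝ × EuclideanSpace ℝ (Fin 3)) : Set (ℝ × EuclideanSpace ℝ (Fin 3))),
          ENNReal.ofReal (frobeniusNormSq (G z.1 z.2)) < ⊤) ∧
        ∀ φ : ℝ → EuclideanSpace ℝ (Fin 3) → ℝ,
          IsSpaceTimeTestOn (parabolicCylinderOpens 1 (0 : ℝ × EuclideanSpace ℝ (Fin 3))) φ →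
          (∀ t x, 0 ≤ φ t x) →
          2 * ∫ t, ∫ x, frobeniusNormSq (G t x) * φ t x ≤
            ∫ t, ∫ x, (‖W t x - driftField W t x‖ ^ 2 * (timeDeriv φ t x + Δ (φ t) x) +
              ‖W t x - driftField W t x‖ ^ 2 *
                ⟪(1 : ℝ) • (W t x - driftField W t x) + driftField W t x, gradient (φ t) x⟫ -
              2 * ⟪driftGrad W t x (W t x - driftField W t x), W t x - driftField W t x⟫ * φ t x +
              2 * pressureField W P t x * ⟪W t x - driftField W t x, gradient (φ t) x⟫ +
              2 * ⟪forceField W t x, W t x - driftField W t x⟫ * φ t x)) :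
    ∃ C₁ : ℝ, 0 < C₁ ∧
      ∀ (u : ℝ → EuclideanSpace ℝ (Fin 3) → EuclideanSpace ℝ (Fin 3))
        (p : ℝ → EuclideanSpace ℝ (Fin 3) → ℝ),
      IsSuitableWeakSolutionOn (parabolicCylinderOpens 2 0) 1 0 u p →
      cknAEss 2 0 u < ⊤ →
      (∃ G : ℝ → EuclideanSpace ℝ (Fin 3) →
          EuclideanSpace ℝ (Fin 3) →L[ℝ] EuclideanSpace ℝ (Fin 3),
        HasWeakSpatialGradientOn (parabolicCylinderOpens 2 0) u G ∧ cknE 2 0 G < ⊤) →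
      cknD 2 (0 : ℝ × EuclideanSpace ℝ (Fin 3)) p < ⊤ →
      cknC 2 0 u < ⊤ →
      ∃ (v h f : ℝ → EuclideanSpace ℝ (Fin 3) → EuclideanSpace ℝ (Fin 3))
        (Dh : ℝ → EuclideanSpace ℝ (Fin 3) →
          EuclideanSpace ℝ (Fin 3) →L[ℝ] EuclideanSpace ℝ (Fin 3))
        (q : ℝ → EuclideanSpace ℝ (Fin 3) → ℝ),
        (∀ᵐ z : ℝ × EuclideanSpace ℝ (Fin 3) ∂(volume.restrict (parabolicCylinder 1 0)),
          u z.1 z.2 = v z.1 z.2 + h z.1 z.2) ∧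
        Kwon2023.IsPerturbedSuitableOn (parabolicCylinderOpens 1 0) 1 h Dh f v q ∧
        eLpNorm (uncurry h) ∞ (volume.restrict (parabolicCylinder (1 / 2) 0)) < ⊤ ∧
        eLpNorm (uncurry v) 3 (volume.restrict (parabolicCylinder 1 0)) ≤
          ENNReal.ofReal C₁ * eLpNorm (uncurry u) 3 (volume.restrict (parabolicCylinder 2 0)) ∧
        eLpNorm (uncurry q) (3 / 2) (volume.restrict (parabolicCylinder 1 0)) ≤
          ENNReal.ofReal C₁ *
            eLpNorm (uncurry u) 3 (volume.restrict (parabolicCylinder 2 0)) ^ 2 ∧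
        (∫⁻ t in Ioo (-1 : ℝ) 0, (eLpNorm (h t) ∞ (volume.restrict (ball 0 1)) +
            eLpNorm (Dh t) ∞ (volume.restrict (ball 0 1))) ^ (3 : ℝ)) ^ (1 / 3 : ℝ) ≤
          ENNReal.ofReal C₁ * eLpNorm (uncurry u) 3 (volume.restrict (parabolicCylinder 2 0)) ∧
        (∫⁻ t in Ioo (-1 : ℝ) 0,
            eLpNorm (f t) ∞ (volume.restrict (ball 0 1)) ^ (3 / 2 : ℝ)) ^ (2 / 3 : ℝ) ≤
          ENNReal.ofReal C₁ *
            (eLpNorm (uncurry u) 3 (volume.restrict (parabolicCylinder 2 0)) +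
              eLpNorm (uncurry u) 3 (volume.restrict (parabolicCylinder 2 0)) ^ 2) := by
  obtain ⟨Cv, hCv0, hCv⟩ := exists_eLpNorm_sub_driftField_le
  obtain ⟨Cq, hCq0, hCq⟩ := exists_pressureField_representative
  obtain ⟨Ch, hCh0, hCh⟩ := exists_driftNorm_le
  obtain ⟨Cf, hCf0, hCf⟩ := exists_forceNorm_le
  set C₁ : ℝ := max (max Cv Cq) (max Ch Cf) with hC₁
  have hv₁ : ENNReal.ofReal Cv ≤ ENNReal.ofReal C₁ :=
    ENNReal.ofReal_le_ofReal ((le_max_left _ _).trans (le_max_left _ _))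
  have hq₁ : ENNReal.ofReal Cq ≤ ENNReal.ofReal C₁ :=
    ENNReal.ofReal_le_ofReal ((le_max_right _ _).trans (le_max_left _ _))
  have hh₁ : ENNReal.ofReal Ch ≤ ENNReal.ofReal C₁ :=
    ENNReal.ofReal_le_ofReal ((le_max_left _ _).trans (le_max_right _ _))
  have hf₁ : ENNReal.ofReal Cf ≤ ENNReal.ofReal C₁ :=
    ENNReal.ofReal_le_ofReal ((le_max_right _ _).trans (le_max_right _ _))
  refine ⟨C₁, lt_max_of_lt_left (lt_max_of_lt_left hCv0), fun u p hs hA hG hD hC => ?_⟩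
  -- the representatives
  obtain ⟨W, hW, hWu⟩ := exists_isGoodVelocity_of_suitable hs hA hC
  obtain ⟨P, hPm, hPae, hqInt, hq32, hestq⟩ := hCq W hW
  set O : Opens (ℝ × EuclideanSpace ℝ (Fin 3)) := parabolicCylinderOpens 1 (0 : ℝ × EuclideanSpace ℝ (Fin 3)) with hOdef
  have hO : O ≤ kwonCyl (-4) 0 1 := parabolicCylinderOpens_one_le_kwonCyl
  have hO' : (O : Set (ℝ × EuclideanSpace ℝ (Fin 3))) ⊆ Ioo (-4 : ℝ) 0 ×ˢ ball (0 : EuclideanSpace ℝ (Fin 3)) 1 := by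
    rw [hOdef, coe_parabolicCylinderOpens, parabolicCylinder_one_zero']
    exact prod_mono (Ioo_subset_Ioo (by norm_num) le_rfl) Subset.rfl
  have hfi : LocallyIntegrableOn (uncurry (forceField W)) (O : Set (ℝ × EuclideanSpace ℝ (Fin 3))) volume :=
    locallyIntegrableOn_forceField hW _
  have hqi : LocallyIntegrableOn (uncurry (pressureField W P)) (O : Set (ℝ × EuclideanSpace ℝ (Fin 3))) volume :=
    (hqInt.mono_set hO').locallyIntegrableOn
  have hX : eLpNorm (uncurry W) 3 (volume.restrict (parabolicCylinder 2 (0 : ℝ × EuclideanSpace ℝ (Fin 3)))) =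
      eLpNorm (uncurry u) 3 (volume.restrict (parabolicCylinder 2 (0 : ℝ × EuclideanSpace ℝ (Fin 3)))) :=
    eLpNorm_repr_eq hWu 3
  -- the perturbed-suitability of `(v, q)` with drift `h` and force `f`
  have hvd : ∀ t x, (fun t x => W t x - driftField W t x) t x = W t x - driftField W t x := fun _ _ => rfl
  have hhd : ∀ t x, driftField W t x = driftField W t x := fun _ _ => rfl
  have hDd : ∀ t x, driftGrad W t x = driftGrad W t x := fun _ _ => rfl
  have hfd : ∀ t x, forceField W t x = forceField W t x := fun _ _ => rfl
  have hqd : ∀ t x, pressureField W P t x = pressureField W P t x := fun _ _ => rfl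
  have hsuit : Kwon2023.IsPerturbedSuitableOn O 1 (driftField W) (driftGrad W) (forceField W)
      (fun t x => W t x - driftField W t x) (pressureField W P) :=
    { locallyIntegrableOn :=
        locallyIntegrableOn_of_eq_sub_driftField (v := fun t x => W t x - driftField W t x) hW hvd _
      locallyIntegrableOn_sq :=
        locallyIntegrableOn_sq_of_eq_sub_driftField (v := fun t x => W t x - driftField W t x) hW hvd _
      energyClass := energyClass_sub_driftField (v := fun t x => W t x - driftField W t x) hW hO hvd
      aestronglyMeasurable_pressure :=
        aestronglyMeasurable_of_eq_pressureField (q := pressureField W P) hW hPm hqd _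
      locallyIntegrableOn_pressure := hqi
      pressure := (lintegral_mono_set hO').trans_lt hq32
      drift := hasWeakSpatialGradientOn_driftField (h := driftField W) (Dh := driftGrad W) hW hhd hDd
      driftClass := driftClass_driftField (h := driftField W) hW hO hhd
      drift_divFree := divFree_driftField (h := driftField W) hW hO hhd
      aestronglyMeasurable_force := aestronglyMeasurable_of_eq_forceField (f := forceField W) hW hfd _
      forceClass := lintegral_sqrt_lintegral_indicator_forceField_sq_lt_top hW 1 0
        (subset_of_eq (coe_parabolicCylinderOpens 1 _))
      force_divFree := divFree_forceField (f := forceField W) hW hfd hfi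
      divFree := divFree_sub_driftField (v := fun t x => W t x - driftField W t x) hW hs.distributional hWu hO hvd
      momentum := momentum_perturbed_pressureField (v := fun t x => W t x - driftField W t x)
        (h := driftField W) (f := forceField W) (q := pressureField W P) hW hs.distributional hWu hO
        hvd hhd hfd hqd hPae hqi hfi
      localEnergy := hLE u p W P hs hA hG hD hC hW hWu hPm hPae }
  refine ⟨fun t x => W t x - driftField W t x, driftField W, forceField W, driftGrad W,
    pressureField W P, ae_eq_add_driftField (v := fun t x => W t x - driftField W t x)
      (h := driftField W) hWu hvd hhd, hsuit,
    eLpNorm_driftField_top_lt_top hW _, ?_, ?_, ?_, ?_⟩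
  · -- (est.v)
    rw [← hX]
    exact (hCv W hW).trans (by gcongr)
  · -- (est.q)
    rw [← hX]
    exact hestq.trans (by gcongr)
  · -- (est.h)
    rw [← hX]
    exact (hCh W hW).trans (by gcongr)
  · -- (est.f)
    rw [← hX]
    exact (hCf W hW).trans (by gcongr)

/-- **Kwon's pressure-free `ε`-regularity criterion (Thm. 1.4, `r = m = 3`, CKN class) from the
local energy inequality of the perturbed system and Thm. 3.1.** The §4 assembly
`kwon2023_velocity_epsilon_regularity_of_lemma25_of_thm31` with Lemma 2.5 supplied by
`kwon2023_lemma25_cubic_of_localEnergy`: the discharge debt of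
`kwon2023_velocity_epsilon_regularity` is exactly the `localEnergy` clause of Lemma 2.5 (`hLE`)
and Thm. 3.1 (`h31`). [cite: Kwon2023RolePressure, §4 (arXiv p. 15) with Lemma 2.5 and Thm. 3.1] -/
theorem kwon2023_velocity_epsilon_regularity_of_localEnergy_of_thm31
    (hLE : ∀ (u : ℝ → EuclideanSpace ℝ (Fin 3) → EuclideanSpace ℝ (Fin 3))
      (p : ℝ → EuclideanSpace ℝ (Fin 3) → ℝ)
      (W : ℝ → EuclideanSpace ℝ (Fin 3) → EuclideanSpace ℝ (Fin 3))
      (P : ℝ → EuclideanSpace ℝ (Fin 3) → ℝ),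
      IsSuitableWeakSolutionOn (parabolicCylinderOpens 2 0) 1 0 u p →
      cknAEss 2 0 u < ⊤ →
      (∃ G : ℝ → EuclideanSpace ℝ (Fin 3) →
          EuclideanSpace ℝ (Fin 3) →L[ℝ] EuclideanSpace ℝ (Fin 3),
        HasWeakSpatialGradientOn (parabolicCylinderOpens 2 0) u G ∧ cknE 2 0 G < ⊤) →
      cknD 2 (0 : ℝ × EuclideanSpace ℝ (Fin 3)) p < ⊤ →
      cknC 2 0 u < ⊤ →
      IsGoodVelocity W →
      uncurry W =ᵐ[volume] (parabolicCylinder 2 (0 : ℝ × EuclideanSpace ℝ (Fin 3))).indicator (uncurry u) →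
      StronglyMeasurable (uncurry P) →
      (∀ᵐ t ∂(volume.restrict (Ioo (-4 : ℝ) 0)), P t =ᵐ[volume] rieszPressure (sqrtCutoffSMul (W t))) →
      ∃ G : ℝ → EuclideanSpace ℝ (Fin 3) → EuclideanSpace ℝ (Fin 3) →L[ℝ] EuclideanSpace ℝ (Fin 3),
        HasWeakSpatialGradientOn (parabolicCylinderOpens 1 (0 : ℝ × EuclideanSpace ℝ (Fin 3)))
          (fun t x => W t x - driftField W t x) G ∧
        (∫⁻ z in (parabolicCylinderOpens 1 (0 : ℝ × EuclideanSpace ℝ (Fin 3)) : Set (ℝ × EuclideanSpace ℝ (Fin 3))),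
          ENNReal.ofReal (frobeniusNormSq (G z.1 z.2)) < ⊤) ∧
        ∀ φ : ℝ → EuclideanSpace ℝ (Fin 3) → ℝ,
          IsSpaceTimeTestOn (parabolicCylinderOpens 1 (0 : ℝ × EuclideanSpace ℝ (Fin 3))) φ →
          (∀ t x, 0 ≤ φ t x) →
          2 * ∫ t, ∫ x, frobeniusNormSq (G t x) * φ t x ≤
            ∫ t, ∫ x, (‖W t x - driftField W t x‖ ^ 2 * (timeDeriv φ t x + Δ (φ t) x) +
              ‖W t x - driftField W t x‖ ^ 2 *
                ⟪(1 : ℝ) • (W t x - driftField W t x) + driftField W t x, gradient (φ t) x⟫ -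
              2 * ⟪driftGrad W t x (W t x - driftField W t x), W t x - driftField W t x⟫ * φ t x +
              2 * pressureField W P t x * ⟪W t x - driftField W t x, gradient (φ t) x⟫ +
              2 * ⟪forceField W t x, W t x - driftField W t x⟫ * φ t x))
    (h31 : ∃ ε₀ : ℝ, 0 < ε₀ ∧
      ∀ (v h f : ℝ → EuclideanSpace ℝ (Fin 3) → EuclideanSpace ℝ (Fin 3))
        (Dh : ℝ → EuclideanSpace ℝ (Fin 3) →
          EuclideanSpace ℝ (Fin 3) →L[ℝ] EuclideanSpace ℝ (Fin 3))
        (q : ℝ → EuclideanSpace ℝ (Fin 3) → ℝ),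
      Kwon2023.IsPerturbedSuitableOn (parabolicCylinderOpens 1 0) 1 h Dh f v q →
      eLpNorm (uncurry v) 3 (volume.restrict (parabolicCylinder 1 0)) ≤ ENNReal.ofReal ε₀ →
      eLpNorm (uncurry q) (3 / 2) (volume.restrict (parabolicCylinder 1 0)) ≤
        ENNReal.ofReal ε₀ →
      (∫⁻ t in Ioo (-1 : ℝ) 0, (eLpNorm (h t) ∞ (volume.restrict (ball 0 1)) +
          eLpNorm (Dh t) ∞ (volume.restrict (ball 0 1))) ^ (3 : ℝ)) ^ (1 / 3 : ℝ) ≤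
        ENNReal.ofReal ε₀ →
      (∫⁻ t in Ioo (-1 : ℝ) 0,
          eLpNorm (f t) ∞ (volume.restrict (ball 0 1)) ^ (3 / 2 : ℝ)) ^ (2 / 3 : ℝ) ≤
        ENNReal.ofReal ε₀ →
      eLpNorm (uncurry v) ∞ (volume.restrict (parabolicCylinder (1 / 2) 0)) < ⊤) :
    kwon2023_velocity_epsilon_regularity :=
  kwon2023_velocity_epsilon_regularity_of_lemma25_of_thm31 (kwon2023_lemma25_cubic_of_localEnergy hLE) h31

/-! ### The assembly modulo the local energy INEQUALITY alone -/

/-- **Lemma 2.5 at `r = m = 3` (binder `h25`) from the local energy INEQUALITY alone.** With the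
weak gradient `∇v = G − ∇h` of `v = W − h` on `Q₁(0)` and its square integrability now theorems
(`hasWeakSpatialGradientOn_sub_driftField`, `lintegral_frobeniusNormSq_sub_driftGrad_lt_top`,
`KwonVelocityGradient.lean`; `G` the CKN weak gradient of `u` on `Q₂(0)`), the hypothesis of
`kwon2023_lemma25_cubic_of_localEnergy` narrows to the bare inequality of Def. 2.4 (`λ = 1`) for
Kwon's explicit fields and the explicit gradient `G − driftGrad W` (Kwon p. 9,
"`2∫|∇v|²ξ dx dt ≤ lim inf_{ε→0}(μ_ε − η_ε)(ξ) − ∫[|v|²(∂ₜξ + Δξ) + …] dx dt`").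
[cite: Kwon2023RolePressure, Lemma 2.5 (arXiv p. 7) with its proof p. 9, case r = m = 3] -/
theorem kwon2023_lemma25_cubic_of_localEnergyIneq
    (hLEI : ∀ (u : ℝ → EuclideanSpace ℝ (Fin 3) → EuclideanSpace ℝ (Fin 3))
      (p : ℝ → EuclideanSpace ℝ (Fin 3) → ℝ)
      (W : ℝ → EuclideanSpace ℝ (Fin 3) → EuclideanSpace ℝ (Fin 3))
      (P : ℝ → EuclideanSpace ℝ (Fin 3) → ℝ)
      (G : ℝ → EuclideanSpace ℝ (Fin 3) → EuclideanSpace ℝ (Fin 3) →L[ℝ] EuclideanSpace ℝ (Fin 3)),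
      IsSuitableWeakSolutionOn (parabolicCylinderOpens 2 0) 1 0 u p →
      cknAEss 2 0 u < ⊤ →
      HasWeakSpatialGradientOn (parabolicCylinderOpens 2 (0 : ℝ × EuclideanSpace ℝ (Fin 3))) u G →
      cknE 2 (0 : ℝ × EuclideanSpace ℝ (Fin 3)) G < ⊤ →
      cknD 2 (0 : ℝ × EuclideanSpace ℝ (Fin 3)) p < ⊤ →
      cknC 2 0 u < ⊤ →
      IsGoodVelocity W →
      uncurry W =ᵐ[volume] (parabolicCylinder 2 (0 : ℝ × EuclideanSpace ℝ (Fin 3))).indicator (uncurry u) →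
      StronglyMeasurable (uncurry P) →
      (∀ᵐ t ∂(volume.restrict (Ioo (-4 : ℝ) 0)), P t =ᵐ[volume] rieszPressure (sqrtCutoffSMul (W t))) →
      ∀ φ : ℝ → EuclideanSpace ℝ (Fin 3) → ℝ,
        IsSpaceTimeTestOn (parabolicCylinderOpens 1 (0 : ℝ × EuclideanSpace ℝ (Fin 3))) φ →
        (∀ t x, 0 ≤ φ t x) →
        2 * ∫ t, ∫ x, frobeniusNormSq (G t x - driftGrad W t x) * φ t x ≤
          ∫ t, ∫ x, (‖W t x - driftField W t x‖ ^ 2 * (timeDeriv φ t x + Δ (φ t) x) +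
            ‖W t x - driftField W t x‖ ^ 2 *
              ⟪(1 : ℝ) • (W t x - driftField W t x) + driftField W t x, gradient (φ t) x⟫ -
            2 * ⟪driftGrad W t x (W t x - driftField W t x), W t x - driftField W t x⟫ * φ t x +
            2 * pressureField W P t x * ⟪W t x - driftField W t x, gradient (φ t) x⟫ +
            2 * ⟪forceField W t x, W t x - driftField W t x⟫ * φ t x)) :
    ∃ C₁ : ℝ, 0 < C₁ ∧
      ∀ (u : ℝ → EuclideanSpace ℝ (Fin 3) → EuclideanSpace ℝ (Fin 3))
        (p : ℝ → EuclideanSpace ℝ (Fin 3) → ℝ),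
      IsSuitableWeakSolutionOn (parabolicCylinderOpens 2 0) 1 0 u p →
      cknAEss 2 0 u < ⊤ →
      (∃ G : ℝ → EuclideanSpace ℝ (Fin 3) →
          EuclideanSpace ℝ (Fin 3) →L[ℝ] EuclideanSpace ℝ (Fin 3),
        HasWeakSpatialGradientOn (parabolicCylinderOpens 2 0) u G ∧ cknE 2 0 G < ⊤) →
      cknD 2 (0 : ℝ × EuclideanSpace ℝ (Fin 3)) p < ⊤ →
      cknC 2 0 u < ⊤ →
      ∃ (v h f : ℝ → EuclideanSpace ℝ (Fin 3) → EuclideanSpace ℝ (Fin 3))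
        (Dh : ℝ → EuclideanSpace ℝ (Fin 3) →
          EuclideanSpace ℝ (Fin 3) →L[ℝ] EuclideanSpace ℝ (Fin 3))
        (q : ℝ → EuclideanSpace ℝ (Fin 3) → ℝ),
        (∀ᵐ z : ℝ × EuclideanSpace ℝ (Fin 3) ∂(volume.restrict (parabolicCylinder 1 0)),
          u z.1 z.2 = v z.1 z.2 + h z.1 z.2) ∧
        Kwon2023.IsPerturbedSuitableOn (parabolicCylinderOpens 1 0) 1 h Dh f v q ∧
        eLpNorm (uncurry h) ∞ (volume.restrict (parabolicCylinder (1 / 2) 0)) < ⊤ ∧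
        eLpNorm (uncurry v) 3 (volume.restrict (parabolicCylinder 1 0)) ≤
          ENNReal.ofReal C₁ * eLpNorm (uncurry u) 3 (volume.restrict (parabolicCylinder 2 0)) ∧
        eLpNorm (uncurry q) (3 / 2) (volume.restrict (parabolicCylinder 1 0)) ≤
          ENNReal.ofReal C₁ *
            eLpNorm (uncurry u) 3 (volume.restrict (parabolicCylinder 2 0)) ^ 2 ∧
        (∫⁻ t in Ioo (-1 : ℝ) 0, (eLpNorm (h t) ∞ (volume.restrict (ball 0 1)) +
            eLpNorm (Dh t) ∞ (volume.restrict (ball 0 1))) ^ (3 : ℝ)) ^ (1 / 3 : ℝ) ≤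
          ENNReal.ofReal C₁ * eLpNorm (uncurry u) 3 (volume.restrict (parabolicCylinder 2 0)) ∧
        (∫⁻ t in Ioo (-1 : ℝ) 0,
            eLpNorm (f t) ∞ (volume.restrict (ball 0 1)) ^ (3 / 2 : ℝ)) ^ (2 / 3 : ℝ) ≤
          ENNReal.ofReal C₁ *
            (eLpNorm (uncurry u) 3 (volume.restrict (parabolicCylinder 2 0)) +
              eLpNorm (uncurry u) 3 (volume.restrict (parabolicCylinder 2 0)) ^ 2) := by
  refine kwon2023_lemma25_cubic_of_localEnergy fun u p W P hs hA hG' hD hC hW hWu hPm hPae => ?_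
  obtain ⟨G, hGu, hE⟩ := hG'
  have hO : parabolicCylinderOpens 1 (0 : ℝ × EuclideanSpace ℝ (Fin 3)) ≤ kwonCyl (-4) 0 1 :=
    parabolicCylinderOpens_one_le_kwonCyl
  have hvd : ∀ t x, (fun t x => W t x - driftField W t x) t x = W t x - driftField W t x := fun _ _ => rfl
  exact ⟨fun t x => G t x - driftGrad W t x,
    hasWeakSpatialGradientOn_sub_driftField (v := fun t x => W t x - driftField W t x) hW hGu hWu hO hvd,
    lintegral_frobeniusNormSq_sub_driftGrad_lt_top hW hGu hE hO,
    hLEI u p W P G hs hA hGu hE hD hC hW hWu hPm hPae⟩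

/-- **Thm. 1.4 (`r = m = 3`, CKN class) from the local energy INEQUALITY of the perturbed system
and Thm. 3.1.** The discharge debt of `kwon2023_velocity_epsilon_regularity` is exactly the bare
inequality `hLEI` (for Kwon's explicit fields and the explicit gradient `G − driftGrad W`) and
Thm. 3.1 (`h31`). [cite: Kwon2023RolePressure, §4 (arXiv p. 15) with Lemma 2.5 and Thm. 3.1] -/
theorem kwon2023_velocity_epsilon_regularity_of_localEnergyIneq_of_thm31
    (hLEI : ∀ (u : ℝ → EuclideanSpace ℝ (Fin 3) → EuclideanSpace ℝ (Fin 3))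
      (p : ℝ → EuclideanSpace ℝ (Fin 3) → ℝ)
      (W : ℝ → EuclideanSpace ℝ (Fin 3) → EuclideanSpace ℝ (Fin 3))
      (P : ℝ → EuclideanSpace ℝ (Fin 3) → ℝ)
      (G : ℝ → EuclideanSpace ℝ (Fin 3) → EuclideanSpace ℝ (Fin 3) →L[ℝ] EuclideanSpace ℝ (Fin 3)),
      IsSuitableWeakSolutionOn (parabolicCylinderOpens 2 0) 1 0 u p →
      cknAEss 2 0 u < ⊤ →
      HasWeakSpatialGradientOn (parabolicCylinderOpens 2 (0 : ℝ × EuclideanSpace ℝ (Fin 3))) u G →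
      cknE 2 (0 : ℝ × EuclideanSpace ℝ (Fin 3)) G < ⊤ →
      cknD 2 (0 : ℝ × EuclideanSpace ℝ (Fin 3)) p < ⊤ →
      cknC 2 0 u < ⊤ →
      IsGoodVelocity W →
      uncurry W =ᵐ[volume] (parabolicCylinder 2 (0 : ℝ × EuclideanSpace ℝ (Fin 3))).indicator (uncurry u) →
      StronglyMeasurable (uncurry P) →
      (∀ᵐ t ∂(volume.restrict (Ioo (-4 : ℝ) 0)), P t =ᵐ[volume] rieszPressure (sqrtCutoffSMul (W t))) →
      ∀ φ : ℝ → EuclideanSpace ℝ (Fin 3) → ℝ,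
        IsSpaceTimeTestOn (parabolicCylinderOpens 1 (0 : ℝ × EuclideanSpace ℝ (Fin 3))) φ →
        (∀ t x, 0 ≤ φ t x) →
        2 * ∫ t, ∫ x, frobeniusNormSq (G t x - driftGrad W t x) * φ t x ≤
          ∫ t, ∫ x, (‖W t x - driftField W t x‖ ^ 2 * (timeDeriv φ t x + Δ (φ t) x) +
            ‖W t x - driftField W t x‖ ^ 2 *
              ⟪(1 : ℝ) • (W t x - driftField W t x) + driftField W t x, gradient (φ t) x⟫ -
            2 * ⟪driftGrad W t x (W t x - driftField W t x), W t x - driftField W t x⟫ * φ t x +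
            2 * pressureField W P t x * ⟪W t x - driftField W t x, gradient (φ t) x⟫ +
            2 * ⟪forceField W t x, W t x - driftField W t x⟫ * φ t x))
    (h31 : ∃ ε₀ : ℝ, 0 < ε₀ ∧
      ∀ (v h f : ℝ → EuclideanSpace ℝ (Fin 3) → EuclideanSpace ℝ (Fin 3))
        (Dh : ℝ → EuclideanSpace ℝ (Fin 3) →
          EuclideanSpace ℝ (Fin 3) →L[ℝ] EuclideanSpace ℝ (Fin 3))
        (q : ℝ → EuclideanSpace ℝ (Fin 3) → ℝ),
      Kwon2023.IsPerturbedSuitableOn (parabolicCylinderOpens 1 0) 1 h Dh f v q →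
      eLpNorm (uncurry v) 3 (volume.restrict (parabolicCylinder 1 0)) ≤ ENNReal.ofReal ε₀ →
      eLpNorm (uncurry q) (3 / 2) (volume.restrict (parabolicCylinder 1 0)) ≤
        ENNReal.ofReal ε₀ →
      (∫⁻ t in Ioo (-1 : ℝ) 0, (eLpNorm (h t) ∞ (volume.restrict (ball 0 1)) +
          eLpNorm (Dh t) ∞ (volume.restrict (ball 0 1))) ^ (3 : ℝ)) ^ (1 / 3 : ℝ) ≤
        ENNReal.ofReal ε₀ →
      (∫⁻ t in Ioo (-1 : ℝ) 0,
          eLpNorm (f t) ∞ (volume.restrict (ball 0 1)) ^ (3 / 2 : ℝ)) ^ (2 / 3 : ℝ) ≤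
        ENNReal.ofReal ε₀ →
      eLpNorm (uncurry v) ∞ (volume.restrict (parabolicCylinder (1 / 2) 0)) < ⊤) :
    kwon2023_velocity_epsilon_regularity :=
  kwon2023_velocity_epsilon_regularity_of_lemma25_of_thm31
    (kwon2023_lemma25_cubic_of_localEnergyIneq hLEI) h31

end Literature.Analysis.FluidPDE

end
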